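import Literature.IUT.HodgeTheaters.StableCurveTemperedDataOfSpecialFibreSec2A3Trichotomy
import HarnessLib

/-!
# [IUTchI] Prop. 2.4 (i)/(ii)/(iii) and Cor. 2.5 at the genuine 𝔛-datum — PER-ITEM HEADS (conjunct projections)

S. Mochizuki, *Inter-universal Teichmüller theory I*, kurims manuscript (May 2020), §2, Prop. 2.4 (i)(ii)(iii)
pp. 50–51 and Cor. 2.5 p. 51 [cite: Mochizuki2012, Prop 2.4 pp.50-51] [cite: Mochizuki2012, Cor 2.5 p.51] (D-0012 claim
key, status disputed; this file takes no side).

PROOF-ONLY sequel (abc-iut cell, seat abc-iut-L5-t11 gen 39) of abc-iut-L5-t11 gen 15's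
`StableCurveTemperedDataOfSpecialFibreSec2A3Trichotomy.lean` (p506978): no definition, no instance, no notation, no new
`Prop` fact, no new mathematics.  PURPOSE (bookkeeping only): the theorem of record
`prop24_cor25_ofPiData_byName_noRF_frame_of_isFreeOrSurface_trichotomy` concludes the CONJUNCTION
`(𝔇.Prop24i ∧ 𝔇.Prop24ii ∧ 𝔇.Prop24iii) ∧ (𝔇.Cor25Decomposition ∧ 𝔇.Cor25Inertia)` at
`𝔇 := ofSpecialFibre X d S h36 Σ Σ̂ …`; an index that binds ONE printed sub-item to ONE kernel theorem whose conclusion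
HEAD is that sub-item's typed predicate (abc-iut-L5-lead RULINGS #277 (β) «conjunct-projection caveat») wants the five
components as separately named theorems.  This file states them — SAME binders VERBATIM (the section variables
`hVc_j`, the arithmetic endpoint data of `Dd j`, the printed trichotomy law `hA3tri_j`, and the explicit binders
(x′) `hF`/`e`, `G`, `hNN`, `σ`, `Λv`, `hvert`, `hΛv`, node data, `hab`, `hadm`, `hI`), conclusion = one conjunct each —
and proves each by projecting the record theorem: components `.1.1`, `.1.2.1`, `.1.2.2`, `.2.1`, `.2.2`.

Law census, honest tags and conditionality are EXACTLY those of the record file (its module docstring): CONDITIONAL on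
the displayed laws `hNN_i` (F-2540 BY NAME) · `hab` · `hadm` · `hI_j^frame` · `hVc_j` · `hA3tri_j` + (x′); the
trichotomy and [SemiAnbd] Thm 5.4 (i) are NOT proved here; typed ≠ inhabited ≠ discharged; nothing here asserts that
abc is proved or refuted, and nothing here bears on [IUTchIII] Cor. 3.12.
-/

noncomputable section

namespace Literature.IUT.HodgeTheaters

open _root_.Topology
open scoped Pointwise
open Literature.AnabelianGeometry.SemiGraphs Literature.AnabelianGeometry.SemiGraphs.ProfiniteSemiGraph

universe uE

namespace StableCurveTemperedData

namespace OfSpecialFibre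

variable {p : ℕ} [Fact p.Prime] (X : TemperedCurve p)

section OneCall

variable (d : X.GroupLevelData) (T : SpecialFibreTower X.DeltaTemp)
  (Sigma SigmaHat : Set ℕ) (hsub : Sigma ⊆ SigmaHat) (hne : Set.Nonempty Sigma)
  (hprime : ∀ q ∈ SigmaHat, q.Prime)
  (S : SpecialFibreData (X.toTemperedArithmeticGroup d)) (h36 : S.Gc.Prop36Hypotheses)
  (hp : p ∉ Sigma) (TpH : Subgroup S.chart.G)
  (HatH : Subgroup (TemperedGraphGroupData.exists_completion_of_prop36 S.Gc h36 S.chart).choose)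
  (hle : TpH.map (TemperedGraphGroupData.exists_completion_of_prop36 S.Gc h36
    S.chart).choose_spec.choose.toMonoidHom ≤ HatH)
  (cuspMeetsH : {x : X.Pt // X.IsCusp x} → Prop)

/-! Section variables COPIED VERBATIM from `StableCurveTemperedDataOfSpecialFibreSec2A3Trichotomy.lean` § B
(documented there): `P`, `Dd`, `hVc`, the arithmetic endpoint data of `Dd j`, and the law `hA3tri`. -/

variable (P : SpecialFibreTower.PiData X d S T) {V B : ℕ → Type*}
  (Dd : ∀ j, DecompositionData ((qTowerOfSpecialFibreTower X T d S h36 Sigma SigmaHat hsub hne hprime hp TpH HatH hle cuspMeetsH P.admKer_normal_pi).Q j).Tp (V j) (B j))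
  (hVc : ∀ (j : ℕ) (v : V j), IsCompact (((Dd j).vertGp v : Subgroup ((qTowerOfSpecialFibreTower X T d S h36 Sigma SigmaHat hsub hne hprime hp TpH HatH hle cuspMeetsH P.admKer_normal_pi).Q j).Tp) : Set ((qTowerOfSpecialFibreTower X T d S h36 Sigma SigmaHat hsub hne hprime hp TpH HatH hle cuspMeetsH P.admKer_normal_pi).Q j).Tp))
  {EA : ℕ → Type uE} (β₁A β₂A : ∀ j, EA j → B j) (srcA tgtA : ∀ j, EA j → V j)
  (c₁A c₂A : ∀ j, EA j → ((qTowerOfSpecialFibreTower X T d S h36 Sigma SigmaHat hsub hne hprime hp TpH HatH hle cuspMeetsH P.admKer_normal_pi).Q j).Tp)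
  (hβe : ∀ j e, (Dd j).edgeOf (β₁A j e) = (Dd j).edgeOf (β₂A j e)) (hβne : ∀ j e, β₁A j e ≠ β₂A j e)
  (hsrcA : ∀ j e, (Dd j).abut (β₁A j e) = some (srcA j e))
  (htgtA : ∀ j e, (Dd j).abut (β₂A j e) = some (tgtA j e))
  (hΓA : ∀ j e, MulAut.conj (c₁A j e) • (Dd j).brGp (β₁A j e) = MulAut.conj (c₂A j e) • (Dd j).brGp (β₂A j e))
  (hloopA : ∀ j e, srcA j e = tgtA j e → (c₁A j e)⁻¹ * c₂A j e ∉ (Dd j).vertGp (srcA j e))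
  (hcovA : ∀ (j : ℕ) (b b' : B j) (v w : V j), (Dd j).edgeOf b = (Dd j).edgeOf b' → b ≠ b' →
    (Dd j).abut b = some v → (Dd j).abut b' = some w →
      ∃ e, (β₁A j e = b ∧ β₂A j e = b') ∨ (β₁A j e = b' ∧ β₂A j e = b))
  (hA3tri : ∀ (j : ℕ) (E : Type uE) (β₁ β₂ : E → B j) (src tgt : E → V j) (c₁ c₂ : E → ((qTowerOfSpecialFibreTower X T d S h36 Sigma SigmaHat hsub hne hprime hp TpH HatH hle cuspMeetsH P.admKer_normal_pi).Q j).Tp),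
    (∀ e, (Dd j).edgeOf (β₁ e) = (Dd j).edgeOf (β₂ e)) → (∀ e, β₁ e ≠ β₂ e) →
    (∀ e, (Dd j).abut (β₁ e) = some (src e)) → (∀ e, (Dd j).abut (β₂ e) = some (tgt e)) →
    (∀ e, MulAut.conj (c₁ e) • (Dd j).brGp (β₁ e) = MulAut.conj (c₂ e) • (Dd j).brGp (β₂ e)) →
    (∀ e, src e = tgt e → (c₁ e)⁻¹ * c₂ e ∉ (Dd j).vertGp (src e)) →
    (∀ (b b' : B j) (v w : V j), (Dd j).edgeOf b = (Dd j).edgeOf b' → b ≠ b' →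
      (Dd j).abut b = some v → (Dd j).abut b' = some w → ∃ e, (β₁ e = b ∧ β₂ e = b') ∨ (β₁ e = b' ∧ β₂ e = b)) →
    ∀ (Λ : Subgroup X.PiTemp), IsCompact (Λ : Set X.PiTemp) → Λ ≠ ⊥ →
    IsOpen (Λ.map X.augGK.toMonoidHom : Set X.GK) →
    ∀ (v w : V j) (g h γ : ((qTowerOfSpecialFibreTower X T d S h36 Sigma SigmaHat hsub hne hprime hp TpH HatH hle cuspMeetsH P.admKer_normal_pi).Q j).Hat),
      MulAut.conj γ • Λ.map (((qTowerOfSpecialFibreTower X T d S h36 Sigma SigmaHat hsub hne hprime hp TpH HatH hle cuspMeetsH P.admKer_normal_pi).qhat j).comp X.toHat.toMonoidHom) ≤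
          MulAut.conj g • (((Dd j).vertGp v).map ((qTowerOfSpecialFibreTower X T d S h36 Sigma SigmaHat hsub hne hprime hp TpH HatH hle cuspMeetsH P.admKer_normal_pi).Q j).ι).topologicalClosure →
      MulAut.conj γ • Λ.map (((qTowerOfSpecialFibreTower X T d S h36 Sigma SigmaHat hsub hne hprime hp TpH HatH hle cuspMeetsH P.admKer_normal_pi).qhat j).comp X.toHat.toMonoidHom) ≤
          MulAut.conj h • (((Dd j).vertGp w).map ((qTowerOfSpecialFibreTower X T d S h36 Sigma SigmaHat hsub hne hprime hp TpH HatH hle cuspMeetsH P.admKer_normal_pi).Q j).ι).topologicalClosure →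
        (v = w ∧ g⁻¹ * h ∈ (((Dd j).vertGp v).map ((qTowerOfSpecialFibreTower X T d S h36 Sigma SigmaHat hsub hne hprime hp TpH HatH hle cuspMeetsH P.admKer_normal_pi).Q j).ι).topologicalClosure) ∨
        (∃ (e : E) (k : ((qTowerOfSpecialFibreTower X T d S h36 Sigma SigmaHat hsub hne hprime hp TpH HatH hle cuspMeetsH P.admKer_normal_pi).Q j).Hat), ∃ p ∈ (((Dd j).vertGp (src e)).map ((qTowerOfSpecialFibreTower X T d S h36 Sigma SigmaHat hsub hne hprime hp TpH HatH hle cuspMeetsH P.admKer_normal_pi).Q j).ι).topologicalClosure,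
              ∃ q ∈ (((Dd j).vertGp (tgt e)).map ((qTowerOfSpecialFibreTower X T d S h36 Sigma SigmaHat hsub hne hprime hp TpH HatH hle cuspMeetsH P.admKer_normal_pi).Q j).ι).topologicalClosure,
              (src e = v ∧ tgt e = w ∧ g = k * ((qTowerOfSpecialFibreTower X T d S h36 Sigma SigmaHat hsub hne hprime hp TpH HatH hle cuspMeetsH P.admKer_normal_pi).Q j).ι (c₁ e) * p ∧ h = k * ((qTowerOfSpecialFibreTower X T d S h36 Sigma SigmaHat hsub hne hprime hp TpH HatH hle cuspMeetsH P.admKer_normal_pi).Q j).ι (c₂ e) * q) ∨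
              (src e = w ∧ tgt e = v ∧ h = k * ((qTowerOfSpecialFibreTower X T d S h36 Sigma SigmaHat hsub hne hprime hp TpH HatH hle cuspMeetsH P.admKer_normal_pi).Q j).ι (c₁ e) * p ∧ g = k * ((qTowerOfSpecialFibreTower X T d S h36 Sigma SigmaHat hsub hne hprime hp TpH HatH hle cuspMeetsH P.admKer_normal_pi).Q j).ι (c₂ e) * q)) ∨
        (∃ (u : V j) (f : ((qTowerOfSpecialFibreTower X T d S h36 Sigma SigmaHat hsub hne hprime hp TpH HatH hle cuspMeetsH P.admKer_normal_pi).Q j).Hat),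
          (∃ (e : E) (k : ((qTowerOfSpecialFibreTower X T d S h36 Sigma SigmaHat hsub hne hprime hp TpH HatH hle cuspMeetsH P.admKer_normal_pi).Q j).Hat), ∃ p ∈ (((Dd j).vertGp (src e)).map ((qTowerOfSpecialFibreTower X T d S h36 Sigma SigmaHat hsub hne hprime hp TpH HatH hle cuspMeetsH P.admKer_normal_pi).Q j).ι).topologicalClosure,
              ∃ q ∈ (((Dd j).vertGp (tgt e)).map ((qTowerOfSpecialFibreTower X T d S h36 Sigma SigmaHat hsub hne hprime hp TpH HatH hle cuspMeetsH P.admKer_normal_pi).Q j).ι).topologicalClosure,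
              (src e = v ∧ tgt e = u ∧ g = k * ((qTowerOfSpecialFibreTower X T d S h36 Sigma SigmaHat hsub hne hprime hp TpH HatH hle cuspMeetsH P.admKer_normal_pi).Q j).ι (c₁ e) * p ∧ f = k * ((qTowerOfSpecialFibreTower X T d S h36 Sigma SigmaHat hsub hne hprime hp TpH HatH hle cuspMeetsH P.admKer_normal_pi).Q j).ι (c₂ e) * q) ∨
              (src e = u ∧ tgt e = v ∧ f = k * ((qTowerOfSpecialFibreTower X T d S h36 Sigma SigmaHat hsub hne hprime hp TpH HatH hle cuspMeetsH P.admKer_normal_pi).Q j).ι (c₁ e) * p ∧ g = k * ((qTowerOfSpecialFibreTower X T d S h36 Sigma SigmaHat hsub hne hprime hp TpH HatH hle cuspMeetsH P.admKer_normal_pi).Q j).ι (c₂ e) * q)) ∧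
          (∃ (e : E) (k : ((qTowerOfSpecialFibreTower X T d S h36 Sigma SigmaHat hsub hne hprime hp TpH HatH hle cuspMeetsH P.admKer_normal_pi).Q j).Hat), ∃ p ∈ (((Dd j).vertGp (src e)).map ((qTowerOfSpecialFibreTower X T d S h36 Sigma SigmaHat hsub hne hprime hp TpH HatH hle cuspMeetsH P.admKer_normal_pi).Q j).ι).topologicalClosure,
              ∃ q ∈ (((Dd j).vertGp (tgt e)).map ((qTowerOfSpecialFibreTower X T d S h36 Sigma SigmaHat hsub hne hprime hp TpH HatH hle cuspMeetsH P.admKer_normal_pi).Q j).ι).topologicalClosure,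
              (src e = u ∧ tgt e = w ∧ f = k * ((qTowerOfSpecialFibreTower X T d S h36 Sigma SigmaHat hsub hne hprime hp TpH HatH hle cuspMeetsH P.admKer_normal_pi).Q j).ι (c₁ e) * p ∧ h = k * ((qTowerOfSpecialFibreTower X T d S h36 Sigma SigmaHat hsub hne hprime hp TpH HatH hle cuspMeetsH P.admKer_normal_pi).Q j).ι (c₂ e) * q) ∨
              (src e = w ∧ tgt e = u ∧ h = k * ((qTowerOfSpecialFibreTower X T d S h36 Sigma SigmaHat hsub hne hprime hp TpH HatH hle cuspMeetsH P.admKer_normal_pi).Q j).ι (c₁ e) * p ∧ f = k * ((qTowerOfSpecialFibreTower X T d S h36 Sigma SigmaHat hsub hne hprime hp TpH HatH hle cuspMeetsH P.admKer_normal_pi).Q j).ι (c₂ e) * q))))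

include hVc hβe hβne hsrcA htgtA hΓA hloopA hcovA hA3tri in
/-- **[IUTchI] Prop. 2.4 (i) at the genuine 𝔛-datum, (x′)-keyed — per-item head** (the typed predicate `Prop24i` of `ofSpecialFibre …`: inertia subgroups of the maximal compact subgroups, [IUTchI] p. 50).  PROOF: component `.1.1` of the record conjunction theorem
`prop24_cor25_ofPiData_byName_noRF_frame_of_isFreeOrSurface_trichotomy` (p506978), binders VERBATIM; CONDITIONAL exactly as
that theorem is (laws `hNN_i · hab · hadm · hI_j^frame · hVc_j · hA3tri_j` + (x′) displayed, none proved here).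
[cite: Mochizuki2012, Prop 2.4(i) p.50] [claim: Mochizuki2012, status: disputed] -/
theorem prop24i_ofPiData_byName_noRF_frame_of_isFreeOrSurface_trichotomy (x : {x : X.Pt // X.IsCusp x})
    {F : Type} [Group F] (hF : IsFreeOrSurface F) (e : X.DeltaHat ≃ₜ* profiniteCompletion F)
    (G : ∀ i, PSCDatum (levelGraph X T Sigma SigmaHat hsub hne hprime i).Hat)
    (hNN : ∀ i, (G i).VerticialIntersectionNear)
    (σ : ∀ i, (T.Gc i).graph.Vertex ≃ (G i).graph.V) (Λv : ∀ i, (G i).graph.V → Subgroup (T.chart i).G)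
    (hvert : ∀ i (v : (T.Gc i).graph.Vertex), Λv i (σ i v) ∈ verticialSubgroups (T.chart i) v)
    (hΛv : ∀ i v, (Λv i v).map (levelGraph X T Sigma SigmaHat hsub hne hprime i).ι = (G i).vertGp v)
    (src tgt : ∀ i, (G i).graph.N → (G i).graph.V) (c₁ c₂ : ∀ i, (G i).graph.N → (T.chart i).G)
    (hends : ∀ i e, (G i).graph.nodeEnds e = s(src i e, tgt i e))
    (h₁ : ∀ i e, (G i).nodeGp e ≤
      MulAut.conj ((levelGraph X T Sigma SigmaHat hsub hne hprime i).ι (c₁ i e)) • (G i).vertGp (src i e))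
    (h₂ : ∀ i e, (G i).nodeGp e ≤
      MulAut.conj ((levelGraph X T Sigma SigmaHat hsub hne hprime i).ι (c₂ i e)) • (G i).vertGp (tgt i e))
    (hloop : ∀ i e, src i e = tgt i e → (c₁ i e)⁻¹ * c₂ i e ∉ Λv i (src i e))
    (hab : ∀ (i : ℕ) (A : Type) [CommGroup A] [Finite A] (χ : T.N i →* A),
      IsOpen ((χ.ker : Subgroup (T.N i)) : Set (T.N i)) →
      (∀ q : ℕ, q.Prime → q ∣ Nat.card A → q ∈ Sigma) → (T.adm i).toMonoidHom.ker ≤ χ.ker)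
    (hadm : ∀ U ∈ 𝓝 (1 : ↥X.DeltaTemp), ∃ j, ((T.admKer j : Subgroup ↥X.DeltaTemp) : Set ↥X.DeltaTemp) ⊆ U)
    (hI : ∀ j, haveI := qTower_map_N_normal X d T Sigma SigmaHat hsub hne hprime S h36 hp TpH HatH hle cuspMeetsH P j;
      ArithMaximalCompactStatementI (Dd j)
        (QuotientGroup.mk' (((T.N j).map X.DeltaTemp.subtype).map ((qTowerOfSpecialFibreTower X T d S h36 Sigma SigmaHat hsub hne hprime hp TpH HatH hle cuspMeetsH P.admKer_normal_pi).qtp j)))) :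
    (ofSpecialFibre X d S h36 Sigma SigmaHat hsub hne hprime hp TpH HatH hle cuspMeetsH).Prop24i :=
  (prop24_cor25_ofPiData_byName_noRF_frame_of_isFreeOrSurface_trichotomy X d T Sigma SigmaHat hsub hne hprime S h36 hp
    TpH HatH hle cuspMeetsH P Dd hVc β₁A β₂A srcA tgtA c₁A c₂A hβe hβne hsrcA htgtA hΓA hloopA hcovA hA3tri x hF e G hNN σ
    Λv hvert hΛv src tgt c₁ c₂ hends h₁ h₂ hloop hab hadm hI).1.1

include hVc hβe hβne hsrcA htgtA hΓA hloopA hcovA hA3tri in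
/-- **[IUTchI] Prop. 2.4 (ii) at the genuine 𝔛-datum, (x′)-keyed — per-item head** (the typed predicate `Prop24ii` of `ofSpecialFibre …`: «`Π^tp_𝔛 ⊆ Π̂_𝔛` is commensurably terminal», [IUTchI] p. 50; the DSIB designation of abc-iut-L5-lead RULINGS #277 (β) with its conjunct-projection caveat met by a named projection).  PROOF: component `.1.2.1` of the record conjunction theorem
`prop24_cor25_ofPiData_byName_noRF_frame_of_isFreeOrSurface_trichotomy` (p506978), binders VERBATIM; CONDITIONAL exactly as
that theorem is (laws `hNN_i · hab · hadm · hI_j^frame · hVc_j · hA3tri_j` + (x′) displayed, none proved here).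
[cite: Mochizuki2012, Prop 2.4(ii) pp.50-51] [claim: Mochizuki2012, status: disputed] -/
theorem prop24ii_ofPiData_byName_noRF_frame_of_isFreeOrSurface_trichotomy (x : {x : X.Pt // X.IsCusp x})
    {F : Type} [Group F] (hF : IsFreeOrSurface F) (e : X.DeltaHat ≃ₜ* profiniteCompletion F)
    (G : ∀ i, PSCDatum (levelGraph X T Sigma SigmaHat hsub hne hprime i).Hat)
    (hNN : ∀ i, (G i).VerticialIntersectionNear)
    (σ : ∀ i, (T.Gc i).graph.Vertex ≃ (G i).graph.V) (Λv : ∀ i, (G i).graph.V → Subgroup (T.chart i).G)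
    (hvert : ∀ i (v : (T.Gc i).graph.Vertex), Λv i (σ i v) ∈ verticialSubgroups (T.chart i) v)
    (hΛv : ∀ i v, (Λv i v).map (levelGraph X T Sigma SigmaHat hsub hne hprime i).ι = (G i).vertGp v)
    (src tgt : ∀ i, (G i).graph.N → (G i).graph.V) (c₁ c₂ : ∀ i, (G i).graph.N → (T.chart i).G)
    (hends : ∀ i e, (G i).graph.nodeEnds e = s(src i e, tgt i e))
    (h₁ : ∀ i e, (G i).nodeGp e ≤
      MulAut.conj ((levelGraph X T Sigma SigmaHat hsub hne hprime i).ι (c₁ i e)) • (G i).vertGp (src i e))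
    (h₂ : ∀ i e, (G i).nodeGp e ≤
      MulAut.conj ((levelGraph X T Sigma SigmaHat hsub hne hprime i).ι (c₂ i e)) • (G i).vertGp (tgt i e))
    (hloop : ∀ i e, src i e = tgt i e → (c₁ i e)⁻¹ * c₂ i e ∉ Λv i (src i e))
    (hab : ∀ (i : ℕ) (A : Type) [CommGroup A] [Finite A] (χ : T.N i →* A),
      IsOpen ((χ.ker : Subgroup (T.N i)) : Set (T.N i)) →
      (∀ q : ℕ, q.Prime → q ∣ Nat.card A → q ∈ Sigma) → (T.adm i).toMonoidHom.ker ≤ χ.ker)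
    (hadm : ∀ U ∈ 𝓝 (1 : ↥X.DeltaTemp), ∃ j, ((T.admKer j : Subgroup ↥X.DeltaTemp) : Set ↥X.DeltaTemp) ⊆ U)
    (hI : ∀ j, haveI := qTower_map_N_normal X d T Sigma SigmaHat hsub hne hprime S h36 hp TpH HatH hle cuspMeetsH P j;
      ArithMaximalCompactStatementI (Dd j)
        (QuotientGroup.mk' (((T.N j).map X.DeltaTemp.subtype).map ((qTowerOfSpecialFibreTower X T d S h36 Sigma SigmaHat hsub hne hprime hp TpH HatH hle cuspMeetsH P.admKer_normal_pi).qtp j)))) :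
    (ofSpecialFibre X d S h36 Sigma SigmaHat hsub hne hprime hp TpH HatH hle cuspMeetsH).Prop24ii :=
  (prop24_cor25_ofPiData_byName_noRF_frame_of_isFreeOrSurface_trichotomy X d T Sigma SigmaHat hsub hne hprime S h36 hp
    TpH HatH hle cuspMeetsH P Dd hVc β₁A β₂A srcA tgtA c₁A c₂A hβe hβne hsrcA htgtA hΓA hloopA hcovA hA3tri x hF e G hNN σ
    Λv hvert hΛv src tgt c₁ c₂ hends h₁ h₂ hloop hab hadm hI).1.2.1

include hVc hβe hβne hsrcA htgtA hΓA hloopA hcovA hA3tri in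
/-- **[IUTchI] Prop. 2.4 (iii) at the genuine 𝔛-datum, (x′)-keyed — per-item head** (the typed predicate `Prop24iii` of `ofSpecialFibre …`, [IUTchI] p. 51; RULINGS #277 (β), conjunct-projection caveat met by a named projection).  PROOF: component `.1.2.2` of the record conjunction theorem
`prop24_cor25_ofPiData_byName_noRF_frame_of_isFreeOrSurface_trichotomy` (p506978), binders VERBATIM; CONDITIONAL exactly as
that theorem is (laws `hNN_i · hab · hadm · hI_j^frame · hVc_j · hA3tri_j` + (x′) displayed, none proved here).
[cite: Mochizuki2012, Prop 2.4(iii) p.51] [claim: Mochizuki2012, status: disputed] -/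
theorem prop24iii_ofPiData_byName_noRF_frame_of_isFreeOrSurface_trichotomy (x : {x : X.Pt // X.IsCusp x})
    {F : Type} [Group F] (hF : IsFreeOrSurface F) (e : X.DeltaHat ≃ₜ* profiniteCompletion F)
    (G : ∀ i, PSCDatum (levelGraph X T Sigma SigmaHat hsub hne hprime i).Hat)
    (hNN : ∀ i, (G i).VerticialIntersectionNear)
    (σ : ∀ i, (T.Gc i).graph.Vertex ≃ (G i).graph.V) (Λv : ∀ i, (G i).graph.V → Subgroup (T.chart i).G)
    (hvert : ∀ i (v : (T.Gc i).graph.Vertex), Λv i (σ i v) ∈ verticialSubgroups (T.chart i) v)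
    (hΛv : ∀ i v, (Λv i v).map (levelGraph X T Sigma SigmaHat hsub hne hprime i).ι = (G i).vertGp v)
    (src tgt : ∀ i, (G i).graph.N → (G i).graph.V) (c₁ c₂ : ∀ i, (G i).graph.N → (T.chart i).G)
    (hends : ∀ i e, (G i).graph.nodeEnds e = s(src i e, tgt i e))
    (h₁ : ∀ i e, (G i).nodeGp e ≤
      MulAut.conj ((levelGraph X T Sigma SigmaHat hsub hne hprime i).ι (c₁ i e)) • (G i).vertGp (src i e))
    (h₂ : ∀ i e, (G i).nodeGp e ≤
      MulAut.conj ((levelGraph X T Sigma SigmaHat hsub hne hprime i).ι (c₂ i e)) • (G i).vertGp (tgt i e))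
    (hloop : ∀ i e, src i e = tgt i e → (c₁ i e)⁻¹ * c₂ i e ∉ Λv i (src i e))
    (hab : ∀ (i : ℕ) (A : Type) [CommGroup A] [Finite A] (χ : T.N i →* A),
      IsOpen ((χ.ker : Subgroup (T.N i)) : Set (T.N i)) →
      (∀ q : ℕ, q.Prime → q ∣ Nat.card A → q ∈ Sigma) → (T.adm i).toMonoidHom.ker ≤ χ.ker)
    (hadm : ∀ U ∈ 𝓝 (1 : ↥X.DeltaTemp), ∃ j, ((T.admKer j : Subgroup ↥X.DeltaTemp) : Set ↥X.DeltaTemp) ⊆ U)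
    (hI : ∀ j, haveI := qTower_map_N_normal X d T Sigma SigmaHat hsub hne hprime S h36 hp TpH HatH hle cuspMeetsH P j;
      ArithMaximalCompactStatementI (Dd j)
        (QuotientGroup.mk' (((T.N j).map X.DeltaTemp.subtype).map ((qTowerOfSpecialFibreTower X T d S h36 Sigma SigmaHat hsub hne hprime hp TpH HatH hle cuspMeetsH P.admKer_normal_pi).qtp j)))) :
    (ofSpecialFibre X d S h36 Sigma SigmaHat hsub hne hprime hp TpH HatH hle cuspMeetsH).Prop24iii :=
  (prop24_cor25_ofPiData_byName_noRF_frame_of_isFreeOrSurface_trichotomy X d T Sigma SigmaHat hsub hne hprime S h36 hp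
    TpH HatH hle cuspMeetsH P Dd hVc β₁A β₂A srcA tgtA c₁A c₂A hβe hβne hsrcA htgtA hΓA hloopA hcovA hA3tri x hF e G hNN σ
    Λv hvert hΛv src tgt c₁ c₂ hends h₁ h₂ hloop hab hadm hI).1.2.2

include hVc hβe hβne hsrcA htgtA hΓA hloopA hcovA hA3tri in
/-- **[IUTchI] Cor. 2.5, decomposition-group clause, at the genuine 𝔛-datum, (x′)-keyed — per-item head** (the typed predicate `Cor25Decomposition` of `ofSpecialFibre …`, [IUTchI] p. 51).  PROOF: component `.2.1` of the record conjunction theorem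
`prop24_cor25_ofPiData_byName_noRF_frame_of_isFreeOrSurface_trichotomy` (p506978), binders VERBATIM; CONDITIONAL exactly as
that theorem is (laws `hNN_i · hab · hadm · hI_j^frame · hVc_j · hA3tri_j` + (x′) displayed, none proved here).
[cite: Mochizuki2012, Cor 2.5 p.51] [claim: Mochizuki2012, status: disputed] -/
theorem cor25Decomposition_ofPiData_byName_noRF_frame_of_isFreeOrSurface_trichotomy (x : {x : X.Pt // X.IsCusp x})
    {F : Type} [Group F] (hF : IsFreeOrSurface F) (e : X.DeltaHat ≃ₜ* profiniteCompletion F)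
    (G : ∀ i, PSCDatum (levelGraph X T Sigma SigmaHat hsub hne hprime i).Hat)
    (hNN : ∀ i, (G i).VerticialIntersectionNear)
    (σ : ∀ i, (T.Gc i).graph.Vertex ≃ (G i).graph.V) (Λv : ∀ i, (G i).graph.V → Subgroup (T.chart i).G)
    (hvert : ∀ i (v : (T.Gc i).graph.Vertex), Λv i (σ i v) ∈ verticialSubgroups (T.chart i) v)
    (hΛv : ∀ i v, (Λv i v).map (levelGraph X T Sigma SigmaHat hsub hne hprime i).ι = (G i).vertGp v)
    (src tgt : ∀ i, (G i).graph.N → (G i).graph.V) (c₁ c₂ : ∀ i, (G i).graph.N → (T.chart i).G)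
    (hends : ∀ i e, (G i).graph.nodeEnds e = s(src i e, tgt i e))
    (h₁ : ∀ i e, (G i).nodeGp e ≤
      MulAut.conj ((levelGraph X T Sigma SigmaHat hsub hne hprime i).ι (c₁ i e)) • (G i).vertGp (src i e))
    (h₂ : ∀ i e, (G i).nodeGp e ≤
      MulAut.conj ((levelGraph X T Sigma SigmaHat hsub hne hprime i).ι (c₂ i e)) • (G i).vertGp (tgt i e))
    (hloop : ∀ i e, src i e = tgt i e → (c₁ i e)⁻¹ * c₂ i e ∉ Λv i (src i e))
    (hab : ∀ (i : ℕ) (A : Type) [CommGroup A] [Finite A] (χ : T.N i →* A),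
      IsOpen ((χ.ker : Subgroup (T.N i)) : Set (T.N i)) →
      (∀ q : ℕ, q.Prime → q ∣ Nat.card A → q ∈ Sigma) → (T.adm i).toMonoidHom.ker ≤ χ.ker)
    (hadm : ∀ U ∈ 𝓝 (1 : ↥X.DeltaTemp), ∃ j, ((T.admKer j : Subgroup ↥X.DeltaTemp) : Set ↥X.DeltaTemp) ⊆ U)
    (hI : ∀ j, haveI := qTower_map_N_normal X d T Sigma SigmaHat hsub hne hprime S h36 hp TpH HatH hle cuspMeetsH P j;
      ArithMaximalCompactStatementI (Dd j)
        (QuotientGroup.mk' (((T.N j).map X.DeltaTemp.subtype).map ((qTowerOfSpecialFibreTower X T d S h36 Sigma SigmaHat hsub hne hprime hp TpH HatH hle cuspMeetsH P.admKer_normal_pi).qtp j)))) :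
    (ofSpecialFibre X d S h36 Sigma SigmaHat hsub hne hprime hp TpH HatH hle cuspMeetsH).Cor25Decomposition :=
  (prop24_cor25_ofPiData_byName_noRF_frame_of_isFreeOrSurface_trichotomy X d T Sigma SigmaHat hsub hne hprime S h36 hp
    TpH HatH hle cuspMeetsH P Dd hVc β₁A β₂A srcA tgtA c₁A c₂A hβe hβne hsrcA htgtA hΓA hloopA hcovA hA3tri x hF e G hNN σ
    Λv hvert hΛv src tgt c₁ c₂ hends h₁ h₂ hloop hab hadm hI).2.1

include hVc hβe hβne hsrcA htgtA hΓA hloopA hcovA hA3tri in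
/-- **[IUTchI] Cor. 2.5, inertia-group clause, at the genuine 𝔛-datum, (x′)-keyed — per-item head** (the typed predicate `Cor25Inertia` of `ofSpecialFibre …`, [IUTchI] p. 51).  PROOF: component `.2.2` of the record conjunction theorem
`prop24_cor25_ofPiData_byName_noRF_frame_of_isFreeOrSurface_trichotomy` (p506978), binders VERBATIM; CONDITIONAL exactly as
that theorem is (laws `hNN_i · hab · hadm · hI_j^frame · hVc_j · hA3tri_j` + (x′) displayed, none proved here).
[cite: Mochizuki2012, Cor 2.5 p.51] [claim: Mochizuki2012, status: disputed] -/
theorem cor25Inertia_ofPiData_byName_noRF_frame_of_isFreeOrSurface_trichotomy (x : {x : X.Pt // X.IsCusp x})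
    {F : Type} [Group F] (hF : IsFreeOrSurface F) (e : X.DeltaHat ≃ₜ* profiniteCompletion F)
    (G : ∀ i, PSCDatum (levelGraph X T Sigma SigmaHat hsub hne hprime i).Hat)
    (hNN : ∀ i, (G i).VerticialIntersectionNear)
    (σ : ∀ i, (T.Gc i).graph.Vertex ≃ (G i).graph.V) (Λv : ∀ i, (G i).graph.V → Subgroup (T.chart i).G)
    (hvert : ∀ i (v : (T.Gc i).graph.Vertex), Λv i (σ i v) ∈ verticialSubgroups (T.chart i) v)
    (hΛv : ∀ i v, (Λv i v).map (levelGraph X T Sigma SigmaHat hsub hne hprime i).ι = (G i).vertGp v)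
    (src tgt : ∀ i, (G i).graph.N → (G i).graph.V) (c₁ c₂ : ∀ i, (G i).graph.N → (T.chart i).G)
    (hends : ∀ i e, (G i).graph.nodeEnds e = s(src i e, tgt i e))
    (h₁ : ∀ i e, (G i).nodeGp e ≤
      MulAut.conj ((levelGraph X T Sigma SigmaHat hsub hne hprime i).ι (c₁ i e)) • (G i).vertGp (src i e))
    (h₂ : ∀ i e, (G i).nodeGp e ≤
      MulAut.conj ((levelGraph X T Sigma SigmaHat hsub hne hprime i).ι (c₂ i e)) • (G i).vertGp (tgt i e))
    (hloop : ∀ i e, src i e = tgt i e → (c₁ i e)⁻¹ * c₂ i e ∉ Λv i (src i e))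
    (hab : ∀ (i : ℕ) (A : Type) [CommGroup A] [Finite A] (χ : T.N i →* A),
      IsOpen ((χ.ker : Subgroup (T.N i)) : Set (T.N i)) →
      (∀ q : ℕ, q.Prime → q ∣ Nat.card A → q ∈ Sigma) → (T.adm i).toMonoidHom.ker ≤ χ.ker)
    (hadm : ∀ U ∈ 𝓝 (1 : ↥X.DeltaTemp), ∃ j, ((T.admKer j : Subgroup ↥X.DeltaTemp) : Set ↥X.DeltaTemp) ⊆ U)
    (hI : ∀ j, haveI := qTower_map_N_normal X d T Sigma SigmaHat hsub hne hprime S h36 hp TpH HatH hle cuspMeetsH P j;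
      ArithMaximalCompactStatementI (Dd j)
        (QuotientGroup.mk' (((T.N j).map X.DeltaTemp.subtype).map ((qTowerOfSpecialFibreTower X T d S h36 Sigma SigmaHat hsub hne hprime hp TpH HatH hle cuspMeetsH P.admKer_normal_pi).qtp j)))) :
    (ofSpecialFibre X d S h36 Sigma SigmaHat hsub hne hprime hp TpH HatH hle cuspMeetsH).Cor25Inertia :=
  (prop24_cor25_ofPiData_byName_noRF_frame_of_isFreeOrSurface_trichotomy X d T Sigma SigmaHat hsub hne hprime S h36 hp
    TpH HatH hle cuspMeetsH P Dd hVc β₁A β₂A srcA tgtA c₁A c₂A hβe hβne hsrcA htgtA hΓA hloopA hcovA hA3tri x hF e G hNN σ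
    Λv hvert hΛv src tgt c₁ c₂ hends h₁ h₂ hloop hab hadm hI).2.2

end OneCall

end OfSpecialFibre

end StableCurveTemperedData

end Literature.IUT.HodgeTheaters

end
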